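import Summits.QuantumFields.YangMills.Theorems.BalabanUVNodesN07HalvingStepTopOfLocalLetters
import Summits.QuantumFields.YangMills.Theorems.UnitScaleTiltProp8HalvingQuarterMatrix
import Summits.QuantumFields.YangMills.Theorems.BalabanUVNodesK0FlatCubeOpsTextP
import Literature.MathematicalPhysics.QuantumFieldTheory.Balaban1983to89.B8Eq12HodgeLaplacianV1
import HarnessLib

/-!
# BalabanUVNodes ∕ N07 — S6, THE `HB` SUMMAND OF (159) IN THE CURRENCY OF THE HEAD: **print's three letters `|X|, |∇^ξX|, |∂^{ξ*}∂^ξX|` of a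
# MATRIX-valued bond field on a window `Y ⊂ T_η` (g0's `Letters10On Y ξ t X`) FROM REAL ROWS** — the rows [15] (164) delivers for every REAL datum
# (k0-s1-w3's S5 socket `K0S5HBRowsAtRecordTori.hbRows164_levelRadii_cubeSeq_T4`: `|HX(b)|`, `Lᵏ|HX(b + e_κ) − HX(b)|`, `|(∂*∂HX)(b)|` at every fine bond,
# `∂*∂ = dcsE ∘ dcE` of `B6SectAOperatorsV1`), read through every real functional of `M_N(ℂ)` and re-assembled LOSSLESSLY by duality

Cell `pub-ymgap`, width seat `pub-ymgap-dag-n07-w4` gen 2 (director-ym №197 ∕ HUMAN RULING D-0149), node N07 = [15] = T. Bałaban, *The variational problem and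
background fields in renormalization group method for lattice gauge theories*, Commun. Math. Phys. **102** (1985) 277–309 [Balaban1985Variational]; [6] =
[Balaban1985RegularSpaces]; sub-target S6 of plan g81's `W-SEAT-START-LIST.md` v8 § n07 item 4 (the ASSEMBLY (165)–(167) → (168) → `HalvingStepTop` → stub 1), piece
«the `HB` summand's letters from the S5 rows» (bus CLAIM ∕ INTENT-1 of g2).  `--kind proof --supports stmt-QuantumFields-20542 --as helper`; count-neutral; def-free;
CONSUMED BY NAME, nothing restated: k0-s1-w3's generic weights `K0FlatCubeOpsTextP.IsLevWeight`, ym3-torus's `FlatCubeLevels.levOf_inOm_eq_top_iff`, g0's `N07HalvingStepTopOfLocalLetters.Letters10On` (the three letters of 33b's `Sect2.LocalGauge10On` without the gauge), 33b's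
`Sect2.curlA ∕ Sect2.codiffCurlA` (`Node00.LocalGaugeCoDivergenceLetters`), r11's `B12RegularSpaces111.grad`, lit-balaban's `B6SectAOperatorsV1.dcE ∕ dcsE` with
`B8Eq12HodgeLaplacianV1.dcsE_apply` ([6] (1.2) at `U ≡ 1`), `LatticeFieldCalculus.curl ∕ pdiffAdj`, and cell ym3-torus's duality lemma
`HalvingQuarterMatrix.norm_le_of_forall_reFunctional` (ym-ust-19200-w3).

WHY.  Print (p. 303–304): *«|HB|, |∇^ηHB|, |∂^{η*}∂^ηHB|, |Δ^ηHB| ≦ B₀ Σ_{c∈ℭ_k} e^{−δ₀d(y₁,c₋)}(L^{j(c)}η)^{−1}|B(c)| < … (161) … Then we get on Δ  |HB|, |∇^ηHB|,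
|∂^{η*}∂^ηHB|, |Δ^ηHB| < ¼M_Δ max{B₃ε₁, ½ε₀}. (164)  This bound, the equality (159) and Eq. (158) imply |A|, |∇^ηA|, |∂^{η*}∂^ηA|, |Δ^ηA| < … (165)»*, with
(p. 288) *«suppressed matrix indices»*: the datum `B(c) = (1∕i)·log(…)` is `𝔤 = 𝔰𝔲(N)`-valued and `H` is a REAL operator acting componentwise.  In the tree the
S5 socket delivers the rows of (164) for REAL data `X : 𝔅 → ℝ` in the letters of `B6SectAOperatorsV1` (`Lᵏ`-differences and `∂*∂ = dcsE (Lᵏ) ∘ dcE (Lᵏ)` on the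
fine torus), while the S6 token (`LocalLetters165TopStepCore`, through g0's `localGauge10On_of_eq159`) asks for `Letters10On Y η_k t 𝔄` — 33b's TORUS letters
`‖𝔄(b)‖`, `‖∇^{η_k}_μ𝔄_ν(x)‖`, `‖(∂^{η_k*}∂^{η_k}𝔄)(b)‖` in the `L²`-operator norm of `M_N(ℂ)`.  THIS FILE is the dictionary between the two and the
lossless re-assembly: for every real-valued ADDITIVE, REAL-HOMOGENEOUS functional `φ` of `M_N(ℂ)` (in particular `y ↦ r·Re(u·f(y))`, `f` a continuous
`ℂ`-linear functional — the class of the duality lemma), `φ` of each torus letter of `𝔄` IS the corresponding `B6SectAOperatorsV1` letter of the real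
field `φ ∘ 𝔄` on the SAME lattice (no support, no periodicity condition: both sides live on `T_η`), and `‖M‖ = sup_φ φ(M)` puts the three letters of
`𝔄` below any `t > q` once the real rows are `≤ q` for all `φ`.  (Bounding the `N²` components separately would cost a dimensional factor the
(165)-budget cannot absorb uniformly in `N`; cf. ym3-torus's `HalvingQuarterMatrix`, whose §2–§3 do the same for the ℤᵈ PULLBACK letters at d = 3.)

CONTENTS (generic `P : Params`, `N`; `φ : MatA N → ℝ` with `hadd : φ(M + M′) = φ M + φ M′`, `hsmul : φ((a : ℂ)•M) = a·φ M` for real `a`).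
§1 plumbing for such `φ` (`map_zero ∕ neg ∕ sub ∕ sum ∕ inv_smul`), `reFunctional_add ∕ reFunctional_smul` (the duality class qualifies).
§2 THE TORUS STENCIL DICTIONARY: `apply_grad` (`φ(∇^ξ_μF(x)) = ξ⁻¹·(φF(x+e_μ) − φF(x))`), `apply_curlA_of_lt ∕ apply_curlA_of_gt` (`φ((∂^ξ𝔄)(p_{νμ}(y))) =
± curl ξ⁻¹ (φ∘𝔄)` at `Setup`'s positively oriented plaquette), ★★ `apply_codiffCurlA_eq_dcsE_dcE` (`φ((∂^{ξ*}∂^ξ𝔄)(x, x+e_μ)) = (dcsE ξ⁻¹ (dcE ξ⁻¹ (φ∘𝔄)))(⟨x, μ⟩)` —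
33b's second-order letter IS [6] (1.2)'s `∂*∂` componentwise).
§3 ★★★ `letters10On_of_realRows` — `Letters10On Y ξ t 𝔄` from the three real rows `≤ q < t` at every bond BASED in `Y`, for every functional of the duality class
(at `ξ := η_k` the factor `ξ⁻¹ = Lᵏ` of the S5 rows is lit's `BIJ85Sigma422Eta.eta_inv`).
§4 ANY TOWER `D : Domains P` (ym3-torus's `cubeSeqM`, n07-e's `cubeDomains` of a `CubeB8` datum, …): `levWeightP_eq_one_of_inOm_top` (k0-s1-w3's generic weights
`K0FlatCubeOpsTextP.IsLevWeight P k D w` are `1` at bonds based in the top region `Ω_k^{(k)}`; generic twin of ym3-torus's T3 `levWeight_eq_one_of_inOm_top`),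
★ `rows_top_of_weightedRows` (there the WEIGHTED rows are the plain rows), ★★★ `letters10On_of_weightedRowsTop` (§3 ∘ §4: weighted rows at every bond based in a window
`Y` of top-level sites ⇒ `Letters10On Y η_k t 𝔄` — the S5 → S6 socket for the `HB` summand, tower-agnostic).

HONEST FRAMING: count-neutral kernel bookkeeping (finite differences on the torus + Hahn–Banach duality in `M_N(ℂ)` by name); NOTHING of [15]∕[6] asserted or
proved; the rows are HYPOTHESES (their discharge is the S5 socket + the data (160)∕(155) + the kernel identity `φ∘(HB) = H(φ∘B)` of k0-s1-w2's extension
algebra); the tokens `LocalLetters165∕167TopStep(Core)` NOT discharged; stub 1 ∕ K0⁷ ∕ K1⁷ NOT closed; N07 NOT discharged; counts unmoved (typed 28∕28 ·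
discharged 5∕27); one finite 𝕋⁴ programme at fixed ε — R4 closes the conditional finite-𝕋⁴ rung `BalabanLadder.UV` ONLY; the YM mass gap (Clay) is NOT
proved by any of this; nothing continuum ∕ ℝ⁴ ∕ OS.  No `def`, no `instance`, no `notation`, no `sorry`.
-/

set_option autoImplicit false

noncomputable section

open scoped BigOperators Matrix.Norms.L2Operator

namespace Summit.QuantumFields.YangMills.BalabanUVNodes.N07Letters10OfRealRows

open Literature.MathematicalPhysics.QuantumFieldTheory.Balaban1983to89
open Literature.MathematicalPhysics.QuantumFieldTheory.Balaban1983to89.Node00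
open LatticeFieldCalculus (curl pdiffAdj)
open B6SectAOperatorsV1 (dcE dcsE dcE_apply)
open B8Eq12HodgeLaplacianV1 (dcsE_apply)
open B12RegularSpaces111 (grad)
open Summit.QuantumFields.YangMills.BalabanUVNodes.N07HalvingStepTopOfLocalLetters (Letters10On)
open Summit.QuantumFields.YangMills.Theorems.HalvingQuarterMatrix (norm_le_of_forall_reFunctional)
open Summit.QuantumFields.YangMills.Theorems.K0FlatCubeOpsTextP (IsLevWeight)
open Summit.QuantumFields.YangMills.Theorems.FlatCubeLevels (levOf_inOm_eq_top_iff)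
open B6SectADomainsV1 (Domains)
open B11Eq115Space (levOf)

variable {P : Params} {N : ℕ}

/-! ## §1  Additive, real-homogeneous functionals of `M_N(ℂ)` -/

section Functional

variable {φ : MatA N → ℝ}

/-- `φ 0 = 0` for an additive functional. [folklore] -/
theorem map_zero_of_add (hadd : ∀ M M' : MatA N, φ (M + M') = φ M + φ M') : φ 0 = 0 := by
  have h := hadd 0 0
  rw [add_zero] at h
  linarith

/-- `φ(−M) = −φ M` for an additive functional. [folklore] -/
theorem map_neg_of_add (hadd : ∀ M M' : MatA N, φ (M + M') = φ M + φ M') (M : MatA N) : φ (-M) = -φ M := by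
  have h := hadd M (-M)
  rw [add_neg_cancel, map_zero_of_add hadd] at h
  linarith

/-- `φ(M − M′) = φ M − φ M′` for an additive functional. [folklore] -/
theorem map_sub_of_add (hadd : ∀ M M' : MatA N, φ (M + M') = φ M + φ M') (M M' : MatA N) : φ (M - M') = φ M - φ M' := by
  rw [sub_eq_add_neg, hadd, map_neg_of_add hadd, ← sub_eq_add_neg]

/-- `φ(Σ_i M_i) = Σ_i φ(M_i)` for an additive functional. [folklore] -/
theorem map_sum_of_add (hadd : ∀ M M' : MatA N, φ (M + M') = φ M + φ M') {ι : Type*} (s : Finset ι) (M : ι → MatA N) :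
    φ (∑ i ∈ s, M i) = ∑ i ∈ s, φ (M i) := by
  classical
  induction s using Finset.induction_on with
  | empty => simp [map_zero_of_add hadd]
  | insert a s ha ih => rw [Finset.sum_insert ha, Finset.sum_insert ha, hadd, ih]

/-- `φ((ξ : ℂ)⁻¹ • M) = ξ⁻¹·φ M` (the unit factor of the letters is real). [folklore] -/
theorem map_inv_smul (hsmul : ∀ (a : ℝ) (M : MatA N), φ ((a : ℂ) • M) = a * φ M) (ξ : ℝ) (M : MatA N) :
    φ ((ξ : ℂ)⁻¹ • M) = ξ⁻¹ * φ M := by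
  rw [← Complex.ofReal_inv, hsmul]

end Functional

/-- **THE DUALITY CLASS QUALIFIES**: `y ↦ r·Re(u·f(y))` (`f` a continuous `ℂ`-linear functional of `M_N(ℂ)`, `u ∈ ℂ`, `r ∈ ℝ`) is additive.
[cite: Balaban1985Variational, p.288 («suppressed matrix indices»; bookkeeping)] -/
theorem reFunctional_add (f : StrongDual ℂ (MatA N)) (u : ℂ) (r : ℝ) (M M' : MatA N) :
    r * (u * f (M + M')).re = r * (u * f M).re + r * (u * f M').re := by
  rw [map_add, mul_add, Complex.add_re, mul_add]

/-- … and real-homogeneous. [cite: Balaban1985Variational, p.288 (bookkeeping)] -/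
theorem reFunctional_smul (f : StrongDual ℂ (MatA N)) (u : ℂ) (r : ℝ) (a : ℝ) (M : MatA N) :
    r * (u * f ((a : ℂ) • M)).re = a * (r * (u * f M).re) := by
  rw [map_smul, smul_eq_mul, ← mul_assoc u, mul_comm u, mul_assoc, Complex.re_ofReal_mul]
  ring

/-! ## §2  The torus stencil dictionary: `φ` of 33b's letters = the `B6SectAOperatorsV1` letters of `φ ∘ 𝔄` -/

section Dictionary

variable {φ : MatA N → ℝ} (hadd : ∀ M M' : MatA N, φ (M + M') = φ M + φ M')
  (hsmul : ∀ (a : ℝ) (M : MatA N), φ ((a : ℂ) • M) = a * φ M)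
include hadd hsmul

/-- **`∇^ξ` THROUGH `φ`**: `φ(∇^ξ_μF(x)) = ξ⁻¹·(φ(F(x + e_μ)) − φ(F(x)))` (r11's `grad ξ μ F x = ξ⁻¹(F(x+e_μ) − F(x))`).
[cite: Balaban1987RG1, (1.12) p.262; Balaban1985RegularSpaces, (1.1) p.76] -/
theorem apply_grad {i : ℕ} (ξ : ℝ) (μ : Fin P.d) (F : Site P i → MatA N) (x : Site P i) :
    φ (grad ξ μ F x) = ξ⁻¹ * (φ (F (x.shift μ)) - φ (F x)) := by
  rw [grad, map_inv_smul hsmul, map_sub_of_add hadd]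

/-- **`∂^ξ` THROUGH `φ`, lower triangle**: for `ν < μ`, `φ((∂^ξ𝔄)(p_{νμ}(y))) = (curl ξ⁻¹ (φ∘𝔄))(⟨y; ν, μ⟩)` — 33b's `Sect2.curlA ξ 𝔄 y ν μ = ∇^ξ_ν𝔄_μ(y) −
∇^ξ_μ𝔄_ν(y)` against `LatticeFieldCalculus.curl c A p = c·(A(y,ν) + A(y+e_ν,μ) − A(y+e_μ,ν) − A(y,μ))` at `Setup`'s positively oriented plaquette `⟨y; ν < μ⟩`.
[cite: Balaban1985RegularSpaces, (1.2) p.76; Balaban1984PropagatorsI, (1.2) p.18] -/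
theorem apply_curlA_of_lt (ξ : ℝ) (A : PBond P 0 → MatA N) (y : Site P 0) {ν μ : Fin P.d} (h : ν < μ) :
    φ (Sect2.curlA ξ A y ν μ) = curl ξ⁻¹ (fun b => φ (A b)) ⟨y, ν, μ, h⟩ := by
  rw [Sect2.curlA, map_sub_of_add hadd, apply_grad hadd hsmul, apply_grad hadd hsmul, curl]
  simp only [smul_eq_mul]
  ring

/-- **`∂^ξ` THROUGH `φ`, upper triangle**: for `μ < ν`, `φ((∂^ξ𝔄)(p_{νμ}(y))) = −(curl ξ⁻¹ (φ∘𝔄))(⟨y; μ, ν⟩)` ([6] (1.2) «F_{μν} = −F_{νμ}»).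
[cite: Balaban1985RegularSpaces, (1.2) p.76; Balaban1984PropagatorsI, (1.2) p.18] -/
theorem apply_curlA_of_gt (ξ : ℝ) (A : PBond P 0 → MatA N) (y : Site P 0) {ν μ : Fin P.d} (h : μ < ν) :
    φ (Sect2.curlA ξ A y ν μ) = -curl ξ⁻¹ (fun b => φ (A b)) ⟨y, μ, ν, h⟩ := by
  rw [Sect2.curlA, map_sub_of_add hadd, apply_grad hadd hsmul, apply_grad hadd hsmul, curl]
  simp only [smul_eq_mul]
  ring

/-- ★★ **33b's SECOND-ORDER TORUS LETTER IS [6] (1.2)'s `∂*∂` OF `B6SectAOperatorsV1`, COMPONENTWISE**: for every additive real-homogeneous `φ`,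
`φ((∂^{ξ*}∂^ξ𝔄)(x, x+e_μ)) = (dcsE ξ⁻¹ (dcE ξ⁻¹ (φ ∘ 𝔄)))(⟨x, μ⟩)` — both are `Σ_{ν≠μ} ξ⁻¹[(∂^ξ𝔄)(p_{νμ}(x − e_ν)) − (∂^ξ𝔄)(p_{νμ}(x))]`: 33b sums over all `ν`
with `(∂^ξ𝔄)(p_{μμ}) = 0` (`Sect2.curlA_self`), [6] (1.2) ∕ `dcsE_apply` splits `Σ_{ν<μ}(∂*_νF_{νμ}) − Σ_{ν>μ}(∂*_νF_{μν})` with `F_{μν} = −F_{νμ}`.  SAME lattice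
`T_η` on both sides — no support or periodicity hypothesis (contrast ym3-torus's pullback dictionary `HalvingQuarterMatrix.re_pdiv_plaqCovDeriv_pull` and
n07-e 34a's push-down `codiffCurlA_cover_eq_pdiv`, which cross to `ℤᵈ`).
[cite: Balaban1985RegularSpaces, (1.2) p.76, (1.140) p.100; Balaban1985Variational, Thm 1 (10) p.279, (164) p.304; Balaban1984PropagatorsII, (2.19) p.226] -/
theorem apply_codiffCurlA_eq_dcsE_dcE (ξ : ℝ) (A : PBond P 0 → MatA N) (x : Site P 0) (μ : Fin P.d) :
    φ (Sect2.codiffCurlA ξ A x μ) = dcsE ξ⁻¹ (dcE ξ⁻¹ (WithLp.toLp 2 fun b => φ (A b))) ⟨x, μ⟩ := by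
  rw [dcsE_apply, Sect2.codiffCurlA, map_sum_of_add hadd, ← Finset.sum_sub_distrib]
  refine Finset.sum_congr rfl fun ν _ => ?_
  simp only [dcE_apply]
  rw [map_inv_smul hsmul, map_sub_of_add hadd]
  rcases lt_trichotomy ν μ with h | h | h
  · rw [dif_pos h, dif_neg (not_lt.mpr h.le), apply_curlA_of_lt hadd hsmul _ _ _ h, apply_curlA_of_lt hadd hsmul _ _ _ h, pdiffAdj]
    simp only [smul_eq_mul, sub_zero]
  · subst h
    simp [Sect2.curlA_self, map_zero_of_add hadd]
  · rw [dif_neg (not_lt.mpr h.le), dif_pos h, apply_curlA_of_gt hadd hsmul _ _ _ h, apply_curlA_of_gt hadd hsmul _ _ _ h, pdiffAdj]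
    simp only [smul_eq_mul, zero_sub]
    ring

end Dictionary

/-! ## §3  ★★★ Print's three letters of a matrix field from the real rows -/

section Rows

/-- ★★★ **[15] (164) ⇒ THE `HB`-LETTERS OF (165), AT THE OBJECTS: PRINT's THREE LETTERS OF A MATRIX-VALUED BOND FIELD ON A WINDOW FROM THE REAL ROWS.**  Let
`Y ⊂ T_η` be a site set, `ξ > 0` a unit, `𝔄` an `M_N(ℂ)`-valued bond field, `0 ≤ q < t`.  Suppose that for every functional `φ = (y ↦ r·Re(u·f(y)))` of the duality
class (`f` continuous `ℂ`-linear, `|φ(y)| ≤ ‖y‖` for all `y`) and every bond `b` BASED in `Y` (`b₋ ∈ Y`) the three real rows hold: `|φ(𝔄(b))| ≤ q`,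
`ξ⁻¹·|φ(𝔄(b₋ + e_κ, b_dir)) − φ(𝔄(b))| ≤ q` for every direction `κ`, and `|(dcsE ξ⁻¹ (dcE ξ⁻¹ (φ∘𝔄)))(b)| ≤ q` — the shape in which the S5 socket
`hbRows164_levelRadii_cubeSeq_T4` delivers (164) for the real datum `φ ∘ B` (weights `= 1` on the window, `ξ := η_k`, `ξ⁻¹ = Lᵏ` by lit's `BIJ85Sigma422Eta.eta_inv`).  THEN `Letters10On Y ξ t 𝔄`:
`‖𝔄(b)‖ < t` on the bonds of `Y`, `‖∇^ξ_μ𝔄_ν(x)‖ < t` on its derivative stencils, `‖(∂^{ξ*}∂^ξ𝔄)(b)‖ < t` on its deep bonds — each letter is a matrix whose every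
`φ`-value is the corresponding real row (§2), hence has norm `≤ q` by duality (`HalvingQuarterMatrix.norm_le_of_forall_reFunctional`); every stencil the three
letters read is based at a site of `Y`.  This is the `HB` input `h₂` of g0's `letters10On_of_eq159` ∕ `localGauge10On_of_eq159`.
[cite: Balaban1985Variational, (161) p.303, (164)–(165) p.304, (159) p.303, p.288; Balaban1985RegularSpaces, (1.2) p.76, (1.140) p.100] -/
theorem letters10On_of_realRows [NeZero N] {Y : Set (Site P 0)} {ξ q t : ℝ} (hξ : 0 < ξ) (hq : 0 ≤ q) (hqt : q < t)
    {𝔄 : PBond P 0 → MatA N}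
    (hrows : ∀ (f : StrongDual ℂ (MatA N)) (u : ℂ) (r : ℝ), (∀ y : MatA N, |r * (u * f y).re| ≤ ‖y‖) →
      ∀ b : PBond P 0, b.src ∈ Y →
        |r * (u * f (𝔄 b)).re| ≤ q ∧
        (∀ κ : Fin P.d, ξ⁻¹ * |r * (u * f (𝔄 ⟨b.src.shift κ, b.dir⟩)).re - r * (u * f (𝔄 b)).re| ≤ q) ∧
        |dcsE ξ⁻¹ (dcE ξ⁻¹ (WithLp.toLp 2 fun b' => r * (u * f (𝔄 b')).re)) b| ≤ q) :
    Letters10On Y ξ t 𝔄 := by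
  have hξ' : 0 ≤ ξ⁻¹ := inv_nonneg.mpr hξ.le
  refine ⟨fun b hb => ?_, fun p hp => ?_, fun b hb => ?_⟩
  · -- `‖𝔄(b)‖ ≤ q < t` on the bonds of `Y` (`b₋ ∈ Y`)
    refine lt_of_le_of_lt (norm_le_of_forall_reFunctional (𝔄 b) hq fun f u r hf => ?_) hqt
    exact (le_abs_self _).trans (hrows f u r hf b hb.1).1
  · -- `‖∇^ξ_μ𝔄_ν(x)‖ ≤ q < t` on the derivative stencils (`x ∈ Y`; the row at the bond `⟨x, ν⟩` in the direction `μ`)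
    refine lt_of_le_of_lt (norm_le_of_forall_reFunctional _ hq fun f u r hf => ?_) hqt
    have hrow := (hrows f u r hf ⟨p.1, p.2.2⟩ hp.1).2.1 p.2.1
    have key : r * (u * f (grad ξ p.2.1 (fun y => 𝔄 ⟨y, p.2.2⟩) p.1)).re =
        ξ⁻¹ * (r * (u * f (𝔄 ⟨p.1.shift p.2.1, p.2.2⟩)).re - r * (u * f (𝔄 ⟨p.1, p.2.2⟩)).re) :=
      apply_grad (φ := fun M => r * (u * f M).re) (reFunctional_add f u r) (reFunctional_smul f u r) ξ p.2.1 _ p.1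
    rw [key]
    refine (le_abs_self _).trans ?_
    rwa [abs_mul, abs_of_nonneg hξ']
  · -- `‖(∂^{ξ*}∂^ξ𝔄)(b)‖ ≤ q < t` on the deep bonds (`b₋ ∈ Y`)
    refine lt_of_le_of_lt (norm_le_of_forall_reFunctional _ hq fun f u r hf => ?_) hqt
    have hrow := (hrows f u r hf b hb.1).2.2
    have key : r * (u * f (Sect2.codiffCurlA ξ 𝔄 b.src b.dir)).re =
        dcsE ξ⁻¹ (dcE ξ⁻¹ (WithLp.toLp 2 fun b' => r * (u * f (𝔄 b')).re)) ⟨b.src, b.dir⟩ :=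
      apply_codiffCurlA_eq_dcsE_dcE (φ := fun M => r * (u * f M).re) (reFunctional_add f u r) (reFunctional_smul f u r) ξ 𝔄 b.src b.dir
    rw [key]
    exact (le_abs_self _).trans hrow

end Rows

/-! ## §4  At TOP-LEVEL bonds of a nested family the S5 weights are `1`: the weighted rows feed §3 directly -/

section Weights

variable {k : ℕ} {D : Domains P} {w : ℕ → PBond P 0 → ℝ}

/-- **ON THE TOP REGION `Ω_k^{(k)}` OF ANY NESTED FAMILY THE LEVEL WEIGHTS ARE `1`** (generic carrier): `w m b = (L^{j(b₋)}·L^{−k})^m` with `j(b₋) = k` when the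
`k`-block of `b₋` lies in `Ω_k^{(k)}` (`FlatCubeLevels.levOf_inOm_eq_top_iff`) — the generic-`Params`, generic-`D` twin of ym3-torus's T3 lemma
`HalvingQuarterCubeSeq.levWeight_eq_one_of_inOm_top`, for k0-s1-w3's carrier-generic `K0FlatCubeOpsTextP.IsLevWeight P k D w` (any tower `D`: ym3-torus's `cubeSeqM`,
n07-e's `cubeDomains` of a `CubeB8` datum, …). [cite: Balaban1985Variational, p.286, (152) p.301, (164) p.304 («on Δ»)] -/
theorem levWeightP_eq_one_of_inOm_top (hDk : D.k = k) (hw : IsLevWeight P k D w) {b : PBond P 0} (hb : D.InOm k b.src) (m : ℕ) : w m b = 1 := by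
  rw [hw m b]
  subst hDk
  have hlev : levOf (fun j => {x : Site P 0 | D.InOm j x}) D.k b.src = D.k := (levOf_inOm_eq_top_iff D b.src).2 hb
  rw [hlev]
  have hL : (P.L : ℝ) ≠ 0 := Nat.cast_ne_zero.2 P.L_pos.ne'
  rw [inv_pow, mul_inv_cancel₀ (pow_ne_zero _ hL), one_pow]

/-- ★ **THE WEIGHTED ROWS OF (164) AT A TOP-LEVEL BOND ARE THE PLAIN ROWS**: at a fine bond `b` with `b₋` in the top region, the S5 socket's three non-Laplacian rows
`w₁(b)·(w₁(b)·|F(b)|) ≤ Q`, `w₁(b)·(w₂(b)·Lᵏ·|F(b₋ + e_ν, b_dir) − F(b)|) ≤ Q`, `w₁(b)·(w₃(b)·|(∂*∂F)(b)|) ≤ Q` (the shape of k0-s1-w3's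
`hbRows164_levelRadii_of_adm22_T4` ∕ `hRowsSep_of_adm22_T4` rows for `F := flatH … X`) read `|F(b)| ≤ Q`, `Lᵏ·|F(b₋ + e_ν, b_dir) − F(b)| ≤ Q`, `|(∂*∂F)(b)| ≤ Q` — print's
(164) «on Δ» literally. [cite: Balaban1985Variational, (164) p.304, p.286; Balaban1984PropagatorsII, (2.19) p.226] -/
theorem rows_top_of_weightedRows (hDk : D.k = k) (hw : IsLevWeight P k D w) {b : PBond P 0} (hb : D.InOm k b.src) {F : PBond P 0 → ℝ} {Q : ℝ}
    (h1 : w 1 b * (w 1 b * |F b|) ≤ Q)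
    (h2 : ∀ ν : Fin P.d, w 1 b * (w 2 b * (P.L : ℝ) ^ k * |F ⟨b.src.shift ν, b.dir⟩ - F b|) ≤ Q)
    (h3 : w 1 b * (w 3 b * |(dcsE ((P.L : ℝ) ^ k) (dcE ((P.L : ℝ) ^ k) (WithLp.toLp 2 F))) b|) ≤ Q) :
    |F b| ≤ Q ∧ (∀ ν : Fin P.d, (P.L : ℝ) ^ k * |F ⟨b.src.shift ν, b.dir⟩ - F b| ≤ Q) ∧
      |(dcsE ((P.L : ℝ) ^ k) (dcE ((P.L : ℝ) ^ k) (WithLp.toLp 2 F))) b| ≤ Q := by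
  have hw1 := levWeightP_eq_one_of_inOm_top hDk hw hb 1
  have hw2 := levWeightP_eq_one_of_inOm_top hDk hw hb 2
  have hw3 := levWeightP_eq_one_of_inOm_top hDk hw hb 3
  rw [hw1] at h1 h2 h3
  rw [hw2] at h2
  rw [hw3] at h3
  simp only [one_mul] at h1 h2 h3
  exact ⟨h1, h2, h3⟩

/-- ★★★ **THE S5 → S6 SOCKET FOR THE `HB` SUMMAND, ANY TOWER**: let `D` be a nested family of height `k` on the torus with its P2 level weights `w`, `Y` a window of
TOP-LEVEL sites (`D.InOm k x` for `x ∈ Y` — print's «Δ ⊂ □ ⊂ □_k»), `𝔄` a matrix bond field, `0 ≤ q < t`.  If for every functional `φ = (y ↦ r·Re(u·f(y)))` of the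
duality class and every bond `b` based in `Y` the three WEIGHTED rows of (164) hold for the real field `φ ∘ 𝔄` at the bound `q` (verbatim the shape k0-s1-w3's sockets
deliver for `flatH … (φ ∘ B)`), then `Letters10On Y η_k t 𝔄` (`η_k = L^{−k}`, `η_k⁻¹ = Lᵏ`) — the `HB` input of g0's `letters10On_of_eq159` ∕ `localGauge10On_of_eq159`
⇒ the ∃-clause of `LocalLetters165TopStepCore`.  The kernel identity `φ ∘ (HB) = H(φ ∘ B)` and the data bounds (160)∕(155) stay the consumer's (k0-s1-w2's extension
algebra; S3). [cite: Balaban1985Variational, (164)–(165) p.304, (159) p.303, p.302 («Δ₀ … □ ⊂ □_k»); Balaban1985RegularSpaces, (1.2) p.76, (1.140) p.100] -/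
theorem letters10On_of_weightedRowsTop [NeZero N] (hDk : D.k = k) (hw : IsLevWeight P k D w) {Y : Set (Site P 0)} (hY : ∀ x ∈ Y, D.InOm k x)
    {q t : ℝ} (hq : 0 ≤ q) (hqt : q < t) {𝔄 : PBond P 0 → MatA N}
    (hrows : ∀ (f : StrongDual ℂ (MatA N)) (u : ℂ) (r : ℝ), (∀ y : MatA N, |r * (u * f y).re| ≤ ‖y‖) →
      ∀ b : PBond P 0, b.src ∈ Y →
        w 1 b * (w 1 b * |r * (u * f (𝔄 b)).re|) ≤ q ∧
        (∀ ν : Fin P.d, w 1 b * (w 2 b * (P.L : ℝ) ^ k * |r * (u * f (𝔄 ⟨b.src.shift ν, b.dir⟩)).re - r * (u * f (𝔄 b)).re|) ≤ q) ∧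
        w 1 b * (w 3 b * |(dcsE ((P.L : ℝ) ^ k) (dcE ((P.L : ℝ) ^ k) (WithLp.toLp 2 fun b' => r * (u * f (𝔄 b')).re))) b|) ≤ q) :
    Letters10On Y (P.eta k) t 𝔄 := by
  have hη : 0 < P.eta k := by
    unfold Params.eta
    exact pow_pos (inv_pos.mpr (by exact_mod_cast P.L_pos)) k
  have hηinv : (P.eta k)⁻¹ = (P.L : ℝ) ^ k := by
    unfold Params.eta
    rw [inv_pow, inv_inv]
  refine letters10On_of_realRows hη hq hqt fun f u r hf b hb => ?_
  obtain ⟨h1, h2, h3⟩ := hrows f u r hf b hb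
  obtain ⟨h1', h2', h3'⟩ := rows_top_of_weightedRows hDk hw (hY b.src hb) (F := fun b' => r * (u * f (𝔄 b')).re) h1 h2 h3
  refine ⟨h1', fun κ => ?_, ?_⟩
  · rw [hηinv]
    exact h2' κ
  · rw [hηinv]
    exact h3'

end Weights

end Summit.QuantumFields.YangMills.BalabanUVNodes.N07Letters10OfRealRows

end
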